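import Mathlib
import Literature.MathematicalPhysics.StatisticalMechanics.CrystallizationSymmetries
import Summits.AtomisticToContinuum.Crystallization.Theorems.NashClassCertificatesNashNearFieldStubSmoothRegimeCoercivityWords
import Summits.AtomisticToContinuum.Crystallization.Theorems.NashClassCertificatesNashNearFieldStubCauchyBornSitewiseOfCoercivityLayers

/-!
# Route `NashClassCertificates`, crux `NashNearField` (stmt-AtomisticToContinuum-16827), line `birth`:
# pieces for the stub `stub_cauchyBornSitewiseOfCoercivity`, II — locality, spliced words, far-from-family transfer

The bookkeeping that turns the Cauchy–Born coercivity of PERIOD AVERAGES (CBBC) into a bound on every WINDOW SUM of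
strained site energies of an arbitrary Hägg word (`sw_window_lower_bound`, next file), uniform in the word:

* `sw_F_eq_of_agree`, `sw_cmp_tsum_le` — LOCALITY: the interaction of layer `k` with layer `ℓ` only reads the letters
  between them, so two words that agree (up to a shift) on a window `[A, B)` have, at every layer `k ∈ [A, B)`,
  strained site lattice sums differing by at most `6480 (2/(k-A+1)² + 2/(B-k)²)` (the layers outside, `d⁻⁴` decay);
* `sw_exists_splice` — the window `s(m..m+N-1)` spliced behind the six letters `s(-3..2)` into ONE period of an
  `(N+6)`-periodic Hägg word, which agrees with `s` on `[-3, 2]` and carries the window at the positions `3, …, N+2`;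
* `sw_famFar_of_agree` — the far-from-family premise of CBBC only reads the letters `s(-3..2)` (its witnesses are
  unit-template sites of norm `≤ 3`, hence on the layers `|k| ≤ 3`, `stub_barlowPos_eq_of_agree`), so it transfers
  from `s` to every word agreeing with `s` on `[-3, 2]` (the spliced words of the next file) with the same `r`;
* `sw_sum_window_reindex`, `sw_sum_window_majorant_le` — reindexing of the window and the total `≤ 8` of the
  comparison majorants.

All `[folklore]`.
-/

noncomputable section

open scoped BigOperators
open Literature.MathematicalPhysics.StatisticalMechanics

namespace Summit.AtomisticToContinuum.Crystallization.Theorems.NashClassCertificatesNashNearField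



/-! ## Locality -/

/-- Label differences only read the letters in between: if `t x = t' (x + c)` for `min k ℓ ≤ x < max k ℓ`, then
`L_t ℓ - L_t k = L_{t'} (ℓ + c) - L_{t'} (k + c)`. [folklore] -/
theorem sw_haggLabel_sub_eq_of_agree {t t' : ℤ → ℤ} {k ℓ c : ℤ}
    (h : ∀ x : ℤ, min k ℓ ≤ x → x < max k ℓ → t x = t' (x + c)) :
    haggLabel t ℓ - haggLabel t k = haggLabel t' (ℓ + c) - haggLabel t' (k + c) := by
  rcases le_total k ℓ with hkl | hlk
  · obtain ⟨n, rfl⟩ : ∃ n : ℕ, ℓ = k + n := ⟨(ℓ - k).toNat, by omega⟩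
    rw [show k + (n : ℤ) + c = (k + c) + n by ring, haggLabel_add_natCast, haggLabel_add_natCast,
      add_sub_cancel_left, add_sub_cancel_left, haggWindow_eq, haggWindow_eq]
    refine Finset.sum_congr rfl fun i hi => ?_
    rw [Finset.mem_range] at hi
    rw [show k + c + (i : ℤ) = (k + i) + c by ring]
    exact h (k + i) (by rw [min_eq_left hkl]; omega) (by rw [max_eq_right hkl]; omega)
  · obtain ⟨n, rfl⟩ : ∃ n : ℕ, k = ℓ + n := ⟨(k - ℓ).toNat, by omega⟩
    rw [show ℓ + (n : ℤ) + c = (ℓ + c) + n by ring, haggLabel_add_natCast, haggLabel_add_natCast,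
      haggWindow_eq, haggWindow_eq]
    have hs : ∑ i ∈ Finset.range n, t (ℓ + i) = ∑ i ∈ Finset.range n, t' (ℓ + c + i) := by
      refine Finset.sum_congr rfl fun i hi => ?_
      rw [Finset.mem_range] at hi
      rw [show ℓ + c + (i : ℤ) = (ℓ + i) + c by ring]
      exact h (ℓ + i) (by rw [min_eq_right hlk]; omega) (by rw [max_eq_left hlk]; omega)
    rw [hs]
    ring

/-- **Locality of the strained pair terms.** If `t x = t' (x + c)` for `min k ℓ ≤ x < max k ℓ`, the interaction of
the base point of layer `k` of `G · T_t` with the site `(i, j)` of layer `ℓ` equals that of the base point of layer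
`k + c` of `G · T_{t'}` with the site `(i, j)` of layer `ℓ + c`. [folklore] -/
theorem sw_F_eq_of_agree (G : EuclideanSpace ℝ (Fin 3) →L[ℝ] EuclideanSpace ℝ (Fin 3))
    {t t' : ℤ → ℤ} {k ℓ c : ℤ} (h : ∀ x : ℤ, min k ℓ ≤ x → x < max k ℓ → t x = t' (x + c))
    (ij : ℤ × ℤ) :
    lennardJones (dist (G (barlowPos 1 (Real.sqrt 6 / 3) t k 0 0)) (G (barlowPos 1 (Real.sqrt 6 / 3) t ℓ ij.1 ij.2))) =
      lennardJones (dist (G (barlowPos 1 (Real.sqrt 6 / 3) t' (k + c) 0 0))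
        (G (barlowPos 1 (Real.sqrt 6 / 3) t' (ℓ + c) ij.1 ij.2))) := by
  rw [swF_eq, swF_eq, sw_haggLabel_sub_eq_of_agree h, show ℓ + c - (k + c) = ℓ - k by ring]

/-- The algebraic separation `(k - ℓ)⁴ ≥ (k - A + 1)² (A - ℓ)²` for `ℓ < A ≤ k`, as inverses. [folklore] -/
theorem sw_inv_four_le_of_lt {A k ℓ : ℤ} (hℓ : ℓ < A) (hk : A ≤ k) :
    ((((ℓ - k : ℤ)) : ℝ) ^ 4)⁻¹ ≤ ((((k - A + 1 : ℤ)) : ℝ) ^ 2)⁻¹ * ((((A - ℓ : ℤ)) : ℝ) ^ 2)⁻¹ := by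
  set X : ℝ := (((k - A + 1 : ℤ)) : ℝ) with hX
  set Y : ℝ := (((A - ℓ : ℤ)) : ℝ) with hY
  have hX1 : 1 ≤ X := by rw [hX]; exact_mod_cast (show (1 : ℤ) ≤ k - A + 1 by omega)
  have hY1 : 1 ≤ Y := by rw [hY]; exact_mod_cast (show (1 : ℤ) ≤ A - ℓ by omega)
  have hkl : (((ℓ - k : ℤ)) : ℝ) = -(X + Y - 1) := by rw [hX, hY]; push_cast; ring
  rw [hkl, ← mul_inv, show (-(X + Y - 1)) ^ 4 = ((X + Y - 1) ^ 2) ^ 2 by ring, show X ^ 2 * Y ^ 2 = (X * Y) ^ 2 by ring]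
  apply inv_anti₀ (by positivity)
  apply pow_le_pow_left₀ (by positivity)
  nlinarith [mul_nonneg (sub_nonneg.2 hX1) (sub_nonneg.2 hY1)]

/-- **Window comparison of strained site sums.** If `t x = t' (x + c)` for all `A ≤ x < B` and `A ≤ k < B`, then
`|∑'_q Φ^t_q(k) - ∑'_q Φ^{t'}_q(k + c)| ≤ 6480 (2 (k - A + 1)⁻² + 2 (B - k)⁻²)`: the layers `ℓ ∈ [A, B]`
contribute identically, the others are bounded by the layer bound on both sides. [folklore] -/
theorem sw_cmp_tsum_le (G : EuclideanSpace ℝ (Fin 3) →L[ℝ] EuclideanSpace ℝ (Fin 3))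
    (hG : ∀ v, 4 / 5 * ‖v‖ ≤ ‖G v‖) {t t' : ℤ → ℤ} {A B c k : ℤ}
    (hagree : ∀ x : ℤ, A ≤ x → x < B → t x = t' (x + c)) (hkA : A ≤ k) (hkB : k < B) :
    |(∑' q : ℤ × ℤ × ℤ, lennardJones (dist (G (barlowPos 1 (Real.sqrt 6 / 3) t k 0 0)) (G (barlowPos 1 (Real.sqrt 6 / 3) t q.1 q.2.1 q.2.2)))) - ∑' q : ℤ × ℤ × ℤ, lennardJones (dist (G (barlowPos 1 (Real.sqrt 6 / 3) t' (k + c) 0 0)) (G (barlowPos 1 (Real.sqrt 6 / 3) t' q.1 q.2.1 q.2.2)))| ≤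
      2 * (3240 : ℝ) * (2 * ((((k - A + 1 : ℤ)) : ℝ) ^ 2)⁻¹ + 2 * ((((B - k : ℤ)) : ℝ) ^ 2)⁻¹) := by
  classical
  -- shift the second sum
  set sh : ℤ × ℤ × ℤ ≃ ℤ × ℤ × ℤ := (Equiv.addRight c).prodCongr (Equiv.refl _) with hsh
  have hsh' : ∀ q : ℤ × ℤ × ℤ, sh q = (q.1 + c, q.2) := fun q => rfl
  set g : ℤ × ℤ × ℤ → ℝ := fun q => lennardJones (dist (G (barlowPos 1 (Real.sqrt 6 / 3) t' (k + c) 0 0)) (G (barlowPos 1 (Real.sqrt 6 / 3) t' (sh q).1 (sh q).2.1 (sh q).2.2))) with hg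
  have hg_sum : Summable g := (sw_summable G hG t' (k + c)).comp_injective sh.injective
  have hf_sum := sw_summable G hG t k
  rw [← Equiv.tsum_eq sh (fun q : ℤ × ℤ × ℤ => lennardJones (dist (G (barlowPos 1 (Real.sqrt 6 / 3) t' (k + c) 0 0)) (G (barlowPos 1 (Real.sqrt 6 / 3) t' q.1 q.2.1 q.2.2)))), ← hf_sum.tsum_sub hg_sum]
  -- bound the finite partial sums of the absolute differences
  set D : ℝ := 2 * (3240 : ℝ) * (2 * ((((k - A + 1 : ℤ)) : ℝ) ^ 2)⁻¹ + 2 * ((((B - k : ℤ)) : ℝ) ^ 2)⁻¹) with hD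
  have hpart : ∀ U : Finset (ℤ × ℤ × ℤ), ∑ q ∈ U, |lennardJones (dist (G (barlowPos 1 (Real.sqrt 6 / 3) t k 0 0)) (G (barlowPos 1 (Real.sqrt 6 / 3) t q.1 q.2.1 q.2.2))) - g q| ≤ D := by
    intro U
    set L := U.image Prod.fst with hL
    set W := U.image Prod.snd with hW
    have hstep1 : ∑ q ∈ U, |lennardJones (dist (G (barlowPos 1 (Real.sqrt 6 / 3) t k 0 0)) (G (barlowPos 1 (Real.sqrt 6 / 3) t q.1 q.2.1 q.2.2))) - g q| ≤ ∑ ℓ ∈ L, ∑ ij ∈ W, |lennardJones (dist (G (barlowPos 1 (Real.sqrt 6 / 3) t k 0 0)) (G (barlowPos 1 (Real.sqrt 6 / 3) t ((ℓ, ij)).1 ((ℓ, ij)).2.1 ((ℓ, ij)).2.2))) - g (ℓ, ij)| := by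
      calc ∑ q ∈ U, |lennardJones (dist (G (barlowPos 1 (Real.sqrt 6 / 3) t k 0 0)) (G (barlowPos 1 (Real.sqrt 6 / 3) t q.1 q.2.1 q.2.2))) - g q| ≤ ∑ q ∈ L ×ˢ W, |lennardJones (dist (G (barlowPos 1 (Real.sqrt 6 / 3) t k 0 0)) (G (barlowPos 1 (Real.sqrt 6 / 3) t q.1 q.2.1 q.2.2))) - g q| :=
            Finset.sum_le_sum_of_subset_of_nonneg Finset.subset_product fun q _ _ => abs_nonneg _
        _ = _ := Finset.sum_product _ _ _
    have hfib : ∀ ℓ ∈ L, ∑ ij ∈ W, |lennardJones (dist (G (barlowPos 1 (Real.sqrt 6 / 3) t k 0 0)) (G (barlowPos 1 (Real.sqrt 6 / 3) t ((ℓ, ij)).1 ((ℓ, ij)).2.1 ((ℓ, ij)).2.2))) - g (ℓ, ij)| ≤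
        2 * (3240 : ℝ) * ((if ℓ < A then ((((k - A + 1 : ℤ)) : ℝ) ^ 2)⁻¹ * ((((A - ℓ : ℤ)) : ℝ) ^ 2)⁻¹ else 0) +
          (if B < ℓ then ((((B - k : ℤ)) : ℝ) ^ 2)⁻¹ * ((((ℓ - B : ℤ)) : ℝ) ^ 2)⁻¹ else 0)) := by
      intro ℓ _
      by_cases hin : A ≤ ℓ ∧ ℓ ≤ B
      · -- inside the window: the terms agree
        have hzero : ∀ ij ∈ W, |lennardJones (dist (G (barlowPos 1 (Real.sqrt 6 / 3) t k 0 0)) (G (barlowPos 1 (Real.sqrt 6 / 3) t ((ℓ, ij)).1 ((ℓ, ij)).2.1 ((ℓ, ij)).2.2))) - g (ℓ, ij)| = 0 := by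
          intro ij _
          simp only [hg, hsh']
          rw [sw_F_eq_of_agree G (t := t) (t' := t') (k := k) (ℓ := ℓ) (c := c) (fun x hx1 hx2 =>
            hagree x (le_trans (le_min hkA hin.1) hx1) (lt_of_lt_of_le hx2 (max_le hkB.le hin.2))) ij]
          simp
        rw [Finset.sum_eq_zero hzero]
        have := (show (0 : ℝ) ≤ 3240 by norm_num)
        positivity
      · -- outside: both sides bounded by the layer bound
        have hℓk : ℓ ≠ k := by rintro rfl; exact hin ⟨hkA, hkB.le⟩
        have hb1 := sw_fiber_layer_le G hG t k hℓk W
        have hb2 : ∑ ij ∈ W, |g (ℓ, ij)| ≤ (3240 : ℝ) * ((((ℓ - k : ℤ)) : ℝ) ^ 4)⁻¹ := by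
          have h2 := sw_fiber_layer_le G hG t' (k + c) (ℓ := ℓ + c) (by omega) W
          rw [show ℓ + c - (k + c) = ℓ - k by ring] at h2
          simpa only [hg, hsh'] using h2
        have htri : ∑ ij ∈ W, |lennardJones (dist (G (barlowPos 1 (Real.sqrt 6 / 3) t k 0 0)) (G (barlowPos 1 (Real.sqrt 6 / 3) t ((ℓ, ij)).1 ((ℓ, ij)).2.1 ((ℓ, ij)).2.2))) - g (ℓ, ij)| ≤
            ∑ ij ∈ W, |lennardJones (dist (G (barlowPos 1 (Real.sqrt 6 / 3) t k 0 0)) (G (barlowPos 1 (Real.sqrt 6 / 3) t ((ℓ, ij)).1 ((ℓ, ij)).2.1 ((ℓ, ij)).2.2)))| + ∑ ij ∈ W, |g (ℓ, ij)| := by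
          rw [← Finset.sum_add_distrib]
          exact Finset.sum_le_sum fun ij _ => abs_sub _ _
        rcases not_and_or.1 hin with hlt | hgt
        · rw [not_le] at hlt
          rw [if_pos hlt, if_neg (by omega), add_zero]
          have hsep := sw_inv_four_le_of_lt hlt hkA
          nlinarith [(show (0 : ℝ) ≤ 3240 by norm_num)]
        · rw [not_le] at hgt
          rw [if_neg (by omega), if_pos hgt, zero_add]
          have hsep := sw_inv_four_le_of_lt (A := -B) (k := -k) (ℓ := -ℓ) (by omega) (by omega)
          have e1 : (((-ℓ - -k : ℤ)) : ℝ) ^ 4 = (((ℓ - k : ℤ)) : ℝ) ^ 4 := by push_cast; ring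
          have e3 : (((-B - -ℓ : ℤ)) : ℝ) ^ 2 = (((ℓ - B : ℤ)) : ℝ) ^ 2 := by push_cast; ring
          rw [e1, e3] at hsep
          have e2' : ((((-k - -B + 1 : ℤ)) : ℝ) ^ 2)⁻¹ ≤ ((((B - k : ℤ)) : ℝ) ^ 2)⁻¹ := by
            apply inv_anti₀
            · have : (1:ℝ) ≤ (((B - k : ℤ)) : ℝ) := by exact_mod_cast (show (1 : ℤ) ≤ B - k by omega)
              positivity
            · have : (((-k - -B + 1 : ℤ)) : ℝ) = (((B - k : ℤ)) : ℝ) + 1 := by push_cast; ring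
              rw [this]
              have : (0:ℝ) ≤ (((B - k : ℤ)) : ℝ) := by exact_mod_cast (show (0 : ℤ) ≤ B - k by omega)
              nlinarith
          have hsep' : ((((ℓ - k : ℤ)) : ℝ) ^ 4)⁻¹ ≤ ((((B - k : ℤ)) : ℝ) ^ 2)⁻¹ * ((((ℓ - B : ℤ)) : ℝ) ^ 2)⁻¹ :=
            hsep.trans (mul_le_mul_of_nonneg_right e2' (by positivity))
          nlinarith [(show (0 : ℝ) ≤ 3240 by norm_num)]
    have hstep2 := Finset.sum_le_sum hfib
    refine hstep1.trans (hstep2.trans ?_)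
    rw [← Finset.mul_sum, Finset.sum_add_distrib, hD]
    have hA := sw_sum_inv_sq_lt L A
    have hB := sw_sum_inv_sq_gt L B
    have e1 : ∑ ℓ ∈ L, (if ℓ < A then ((((k - A + 1 : ℤ)) : ℝ) ^ 2)⁻¹ * ((((A - ℓ : ℤ)) : ℝ) ^ 2)⁻¹ else 0) =
        ((((k - A + 1 : ℤ)) : ℝ) ^ 2)⁻¹ * ∑ ℓ ∈ L, (if ℓ < A then ((((A - ℓ : ℤ)) : ℝ) ^ 2)⁻¹ else 0) := by
      rw [Finset.mul_sum]
      refine Finset.sum_congr rfl fun ℓ _ => ?_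
      split_ifs <;> simp
    have e2 : ∑ ℓ ∈ L, (if B < ℓ then ((((B - k : ℤ)) : ℝ) ^ 2)⁻¹ * ((((ℓ - B : ℤ)) : ℝ) ^ 2)⁻¹ else 0) =
        ((((B - k : ℤ)) : ℝ) ^ 2)⁻¹ * ∑ ℓ ∈ L, (if B < ℓ then ((((ℓ - B : ℤ)) : ℝ) ^ 2)⁻¹ else 0) := by
      rw [Finset.mul_sum]
      refine Finset.sum_congr rfl fun ℓ _ => ?_
      split_ifs <;> simp
    rw [e1, e2]
    have hx : (0:ℝ) ≤ ((((k - A + 1 : ℤ)) : ℝ) ^ 2)⁻¹ := by positivity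
    have hy : (0:ℝ) ≤ ((((B - k : ℤ)) : ℝ) ^ 2)⁻¹ := by positivity
    have := (show (0 : ℝ) ≤ 3240 by norm_num)
    nlinarith [mul_le_mul_of_nonneg_left hA hx, mul_le_mul_of_nonneg_left hB hy]
  -- pass to the `tsum`
  have hdiff_abs : Summable fun q => |lennardJones (dist (G (barlowPos 1 (Real.sqrt 6 / 3) t k 0 0)) (G (barlowPos 1 (Real.sqrt 6 / 3) t q.1 q.2.1 q.2.2))) - g q| := (hf_sum.sub hg_sum).abs
  have h1 : ‖∑' q, (lennardJones (dist (G (barlowPos 1 (Real.sqrt 6 / 3) t k 0 0)) (G (barlowPos 1 (Real.sqrt 6 / 3) t q.1 q.2.1 q.2.2))) - g q)‖ ≤ ∑' q, ‖lennardJones (dist (G (barlowPos 1 (Real.sqrt 6 / 3) t k 0 0)) (G (barlowPos 1 (Real.sqrt 6 / 3) t q.1 q.2.1 q.2.2))) - g q‖ :=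
    norm_tsum_le_tsum_norm (by simpa only [Real.norm_eq_abs] using hdiff_abs)
  simp only [Real.norm_eq_abs] at h1
  exact h1.trans (Real.tsum_le_of_sum_le (fun _ => abs_nonneg _) hpart)

/-- `√6/3 ≠ 0`. [folklore] -/
theorem sw_h0_ne : Real.sqrt 6 / 3 ≠ 0 := by positivity

/-! ## The spliced word -/

/-- **The spliced word.**  For a Hägg word `s`, a position `m` and a length `N`, there is an `(N+6)`-periodic Hägg
word `t` one period of which reads `s 0, s 1, s 2`, then the window `s m, …, s (m + N - 1)`, then
`s (-3), s (-2), s (-1)`: `t` agrees with `s` on `[-3, 2]` and carries the window at the positions `3, …, N + 2`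
(`t x = s (x + (m - 3))`). [folklore] -/
theorem sw_exists_splice (s : ℤ → ℤ) (hs : IsHaggSeq s) (m : ℤ) (N : ℕ) :
    ∃ t : ℤ → ℤ, (∀ j : ℤ, t (j + ((N + 6 : ℕ) : ℤ)) = t j) ∧ IsHaggSeq t ∧
      (∀ j : ℤ, -3 ≤ j → j < 3 → t j = s j) ∧ (∀ x : ℤ, 3 ≤ x → x < (N : ℤ) + 3 → t x = s (x + (m - 3))) := by
  set P : ℤ := ((N + 6 : ℕ) : ℤ) with hPdef
  have hP : P = (N : ℤ) + 6 := by rw [hPdef]; push_cast; ring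
  refine ⟨fun j => if j % P < 3 then s (j % P) else if j % P < (N : ℤ) + 3 then s (m + (j % P - 3)) else s (j % P - P),
    fun j => ?_, fun j => ?_, fun j hj1 hj2 => ?_, fun x hx1 hx2 => ?_⟩
  · simp only [hPdef, Int.add_emod_right]
  · simp only
    split_ifs <;> exact hs _
  · simp only
    rcases le_or_gt 0 j with hj | hj
    · have hmod : j % P = j := Int.emod_eq_of_lt hj (by omega)
      rw [hmod, if_pos hj2]
    · have hmod : j % P = j + P := by
        rw [← Int.add_emod_right j P]
        exact Int.emod_eq_of_lt (by omega) (by omega)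
      rw [hmod, if_neg (by omega), if_neg (by omega), add_sub_cancel_right]
  · simp only
    have hmod : x % P = x := Int.emod_eq_of_lt (by omega) (by omega)
    rw [hmod, if_neg (by omega), if_pos hx2]
    congr 1
    ring

/-! ## Far-from-family transfer -/

/-- Sites of the unit template of norm `≤ 3` lie on the layers `|k| ≤ 3`. [folklore] -/
theorem sw_layer_le_three_of_norm_le (s : ℤ → ℤ) {k u v : ℤ}
    (hn : ‖barlowPos 1 (Real.sqrt 6 / 3) s k u v‖ ≤ 3) : -3 ≤ k ∧ k ≤ 3 := by
  have h := PiLp.norm_apply_le (barlowPos 1 (Real.sqrt 6 / 3) s k u v) 2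
  rw [barlowPos_apply_two, Real.norm_eq_abs] at h
  have h1 : |(k : ℝ)| * (Real.sqrt 6 / 3) ≤ 3 := by
    rw [abs_mul, abs_of_pos (by positivity : (0:ℝ) < Real.sqrt 6 / 3)] at h
    exact h.trans hn
  have h2 : |(k : ℝ)| < 4 := by nlinarith [sw_h0_ge, abs_nonneg (k : ℝ)]
  have h3 : |k| < 4 := by
    have : ((|k| : ℤ) : ℝ) < 4 := by rw [Int.cast_abs]; exact h2
    exact_mod_cast this
  constructor <;> [have := (abs_lt.1 h3).1; have := (abs_lt.1 h3).2] <;> omega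

/-- **Far from the family is a property of the letters `s(-3..2)`.**  If `t` agrees with `s` on `[-3, 2]`, the
`r`-far witnesses of `s` (sites of norm `≤ 3`) are `r`-far witnesses of `t`, for any map `F`. [folklore] -/
theorem sw_famFar_of_agree {s t : ℤ → ℤ} (hagree : ∀ i : ℤ, -3 ≤ i → i < 3 → t i = s i)
    (F : EuclideanSpace ℝ (Fin 3) → EuclideanSpace ℝ (Fin 3)) (r : ℝ)
    (hfar : ∀ (A : EuclideanSpace ℝ (Fin 3) →ₗᵢ[ℝ] EuclideanSpace ℝ (Fin 3)) (a h : ℝ), 47 / 50 ≤ a → a ≤ 1 → 39 / 50 * a ≤ h → h ≤ 17 / 20 * a →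
      ∃ k u v : ℤ, ‖barlowPos 1 (Real.sqrt 6 / 3) s k u v‖ ≤ 3 ∧
        r ≤ dist (F (barlowPos 1 (Real.sqrt 6 / 3) s k u v)) (A (barlowPos a h s k u v))) :
    ∀ (A : EuclideanSpace ℝ (Fin 3) →ₗᵢ[ℝ] EuclideanSpace ℝ (Fin 3)) (a h : ℝ), 47 / 50 ≤ a → a ≤ 1 → 39 / 50 * a ≤ h → h ≤ 17 / 20 * a →
      ∃ k u v : ℤ, ‖barlowPos 1 (Real.sqrt 6 / 3) t k u v‖ ≤ 3 ∧
        r ≤ dist (F (barlowPos 1 (Real.sqrt 6 / 3) t k u v)) (A (barlowPos a h t k u v)) := by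
  intro A a h h1 h2 h3 h4
  obtain ⟨k, u, v, hn, hr⟩ := hfar A a h h1 h2 h3 h4
  obtain ⟨hk1, hk2⟩ := sw_layer_le_three_of_norm_le s hn
  have hagree' : ∀ i : ℤ, -((3 : ℕ) : ℤ) ≤ i → i < (3 : ℕ) → t i = s i :=
    fun i hi1 hi2 => hagree i (by omega) (by omega)
  have e1 := stub_barlowPos_eq_of_agree 1 (Real.sqrt 6 / 3) s t 3 hagree' k u v (by omega) (by omega)
  have e2 := stub_barlowPos_eq_of_agree a h s t 3 hagree' k u v (by omega) (by omega)
  exact ⟨k, u, v, by rw [e1]; exact hn, by rw [e1, e2]; exact hr⟩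

/-! ## The uniform window bound -/

/-- Reindexing of the window: `k ↦ k + (m - 3)` maps `[3, N + 3) ⊆ ℕ` onto `[m, n] ⊆ ℤ` (`N = n - m + 1`).
[folklore] -/
theorem sw_sum_window_reindex (f : ℤ → ℝ) {m n : ℤ} {N : ℕ} (hN : (N : ℤ) = n - m + 1) :
    ∑ k ∈ Finset.Ico 3 (N + 3), f ((k : ℤ) + (m - 3)) = ∑ k ∈ Finset.Icc m n, f k := by
  refine Finset.sum_nbij' (fun k : ℕ => (k : ℤ) + (m - 3)) (fun k' : ℤ => (k' - m + 3).toNat) ?_ ?_ ?_ ?_ ?_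
  · intro k hk
    rw [Finset.mem_Ico] at hk
    rw [Finset.mem_Icc]
    constructor <;> omega
  · intro k' hk'
    rw [Finset.mem_Icc] at hk'
    rw [Finset.mem_Ico]
    constructor <;> omega
  · intro k hk
    omega
  · intro k' hk'
    rw [Finset.mem_Icc] at hk'
    show (((k' - m + 3).toNat : ℕ) : ℤ) + (m - 3) = k'
    rw [Int.toNat_of_nonneg (by omega)]
    ring
  · intro k _
    rfl

/-- The two tail sums of the window comparison are each `≤ 2`. [folklore] -/
theorem sw_sum_window_majorant_le (N : ℕ) :
    ∑ k ∈ Finset.Ico 3 (N + 3),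
        (2 * (((((k : ℤ) - 3 + 1 : ℤ)) : ℝ) ^ 2)⁻¹ + 2 * (((((N : ℤ) + 3 - k : ℤ)) : ℝ) ^ 2)⁻¹) ≤ 8 := by
  classical
  set L : Finset ℤ := (Finset.Ico 3 (N + 3)).image (fun k : ℕ => (k : ℤ)) with hL
  have hinj : Set.InjOn (fun k : ℕ => (k : ℤ)) ↑(Finset.Ico 3 (N + 3)) := fun x _ y _ hxy => by
    have h : (x : ℤ) = y := hxy
    exact_mod_cast h
  have h1 : ∑ k ∈ Finset.Ico 3 (N + 3), (((((k : ℤ) - 3 + 1 : ℤ)) : ℝ) ^ 2)⁻¹ ≤ 2 := by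
    have h := sw_sum_inv_sq_gt L 2
    rw [hL, Finset.sum_image hinj] at h
    refine le_trans (le_of_eq (Finset.sum_congr rfl fun k hk => ?_)) h
    rw [Finset.mem_Ico] at hk
    rw [if_pos (by omega), show (k : ℤ) - 3 + 1 = k - 2 by ring]
  have h2 : ∑ k ∈ Finset.Ico 3 (N + 3), (((((N : ℤ) + 3 - k : ℤ)) : ℝ) ^ 2)⁻¹ ≤ 2 := by
    have h := sw_sum_inv_sq_lt L ((N : ℤ) + 3)
    rw [hL, Finset.sum_image hinj] at h
    refine le_trans (le_of_eq (Finset.sum_congr rfl fun k hk => ?_)) h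
    rw [Finset.mem_Ico] at hk
    rw [if_pos (by omega)]
  rw [Finset.sum_add_distrib, ← Finset.mul_sum, ← Finset.mul_sum]
  linarith

/-- **Stub piece `stub_strainedWindowComparison` (proved; registered form of `sw_cmp_tsum_le`).**  If two words
agree up to the shift `c` on the letters of `[A, B)`, then at every layer `k ∈ [A, B)` the strained site lattice sums of
`G · T_t` (base layer `k`) and `G · T_{t'}` (base layer `k + c`) differ by at most `6480 (2 (k-A+1)⁻² + 2 (B-k)⁻²)`.
[folklore] -/
theorem stub_strainedWindowComparison :
    ∀ (G : EuclideanSpace ℝ (Fin 3) →L[ℝ] EuclideanSpace ℝ (Fin 3)),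
      (∀ v : EuclideanSpace ℝ (Fin 3), 4 / 5 * ‖v‖ ≤ ‖G v‖) → ∀ (t t' : ℤ → ℤ) (A B c k : ℤ),
      (∀ x : ℤ, A ≤ x → x < B → t x = t' (x + c)) → A ≤ k → k < B →
      |(∑' q : ℤ × ℤ × ℤ, lennardJones (dist (G (barlowPos 1 (Real.sqrt 6 / 3) t k 0 0))
          (G (barlowPos 1 (Real.sqrt 6 / 3) t q.1 q.2.1 q.2.2)))) -
        ∑' q : ℤ × ℤ × ℤ, lennardJones (dist (G (barlowPos 1 (Real.sqrt 6 / 3) t' (k + c) 0 0))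
          (G (barlowPos 1 (Real.sqrt 6 / 3) t' q.1 q.2.1 q.2.2)))| ≤
        6480 * (2 * ((((k - A + 1 : ℤ)) : ℝ) ^ 2)⁻¹ + 2 * ((((B - k : ℤ)) : ℝ) ^ 2)⁻¹) :=
  fun G hG t t' A B c k hagree hkA hkB =>
    (sw_cmp_tsum_le G hG (t := t) (t' := t') hagree hkA hkB).trans (le_of_eq (by ring))

end Summit.AtomisticToContinuum.Crystallization.Theorems.NashClassCertificatesNashNearField

end
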